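import Literature.NumberTheory.Automorphic.PlaneLatticesHermiteForm              -- ★ p840624 (L5-a): Hermite currency, `IsUniformizingElement`, (D4½) `glInt`, `formCongr`
import Literature.NumberTheory.LocalFields.UnramifiedQuadraticNormFixedPoints      -- ★ p840580 (L5-c) FILE 1: `maximalIdeal_pow_le_comap` (the descended involution `σ̄_j`)
import HarnessLib

/-!
# Self-dual plane lattices in Hermite coordinates: `Λ(T(k, y, l))` is self-dual for the form `ϖ^e · 1` iff `l = -k - e`, `j := 2k + e ≥ 0`,
# `u := ϖ^{k+e} y ∈ 𝒪` and `u σu ≡ -1 (mod ϖ^j)`; the self-dual classes with exponent `k` are counted by `{ū ∈ 𝒪 ⧸ 𝔪^j : ū σ̄ū = -1}`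
(Jacobowitz, *Hermitian forms over local fields* (1962), §7; Flicker, *Elementary proof of the fundamental lemma for a unitary group* (1998), §6 p. 95
REMARK; Macdonald, *Symmetric functions and Hall polynomials*, Ch. V §2; Serre, *Local Fields*, Ch. V §2)

Topic `NumberTheory/Automorphic`; namespace `Literature.NumberTheory.Automorphic`.  THEOREMS ONLY (no definition, no instance, no notation, no named fact,
no `sorry`).  Cell `pub/hodgecm-mathlib`, F0∕P3a, road «D-N7-inert» COUNT programme, sub-brick **(L5-b) «SELF-DUAL ⟺ PARITY + NORM CONGRUENCE»** of B-p10 (g24)'s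
(L5) «H-SIDE VALUE `Φ^st_{1_{K_H}}(t₀) = (q^N(q+1) − 2)∕(q − 1)`» (pre-census bf72064b, LEAD F0P3a-plan (g9) WORD T8-35 (C), B-p10 DEDUP∕PROPOSAL 03:41Z), over
★ (L5-a) `PlaneLatticesHermiteForm` (Hermite currency) and feeding ★ (L5-c) `UnramifiedQuadraticNormFibres` ∕ (L5-d).  HC_CM is proved only modulo the printed
citations until rung 0 closes; nothing printed is asserted here — elementary lattice algebra over a discrete valuation ring.

SETTING (= ★ `PlaneLatticesHermiteForm`).  `F` a field with `[ValuativeRel F]`, `ϖ : F` a uniformizing element (`hϖ : IsUniformizingElement ϖ`), `σ : F →+* F`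
with `σ ϖ = ϖ` (and, where needed, `σ 𝒪 ⊆ 𝒪`, or its restriction `σO : 𝒪[F] →+* 𝒪[F]`, `hσO : ↑(σO x) = σ ↑x`, an involution `hσσ` — the `σ` of ★ (L5-c));
lattices `Λ(g) := Submodule.span 𝒪[F] (Set.range (↑g)ᵀ)`; Hermite matrices named by `hg : ↑g = !![ϖ ^ k, y; 0, ϖ ^ l]`; the FORM is `ϖ ^ e • 1` (`e : ℤ`,
the rescaled eigenframe Gram matrix of (L5-d1)); SELF-DUALITY is the socket's token `∃ J′ ∈ glInt 2 F, ↑J′ = formCongr σ g (ϖ ^ e • 1)` (unimodular Gram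
matrix, ★ `UnitaryUnitOrbitalIntegralLatticeCount`).  Throughout `u := ϖ^{k+e} y` and `j := 2k + e`.

* §1 `zpow_uniformizer_mem_integer_iff` (`ϖ^d ∈ 𝒪 ⟺ 0 ≤ d`); **`formCongr_hermite_smul_one`**: the Gram matrix of `T(k, y, l)` for `ϖ^e · 1` is
  `[[ϖ^{2k+e}, ϖ^{k+e} y], [ϖ^{k+e} σy, ϖ^e (σy·y + ϖ^{2l})]]`.
* §2 **`exists_mem_glInt_coe_eq_formCongr_hermite_iff`**: self-dual ⟺ `l = -k - e ∧ 0 ≤ 2k + e ∧ u ∈ 𝒪 ∧ ϖ^{-j}(u σu + 1) ∈ 𝒪` (then the Gram matrix is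
  `[[ϖ^j, u], [σu, ϖ^{-j}(u σu + 1)]]` of determinant `1`: «integral ⟺ unimodular»; PARITY `j ≡ e (2)`, NORM CONGRUENCE `N(u) ≡ -1 (ϖ^j)`).
* §3 the `u`-COORDINATE: `zpow_neg_mul_sub_eq` (`ϖ^{-j}(u′ − u) = ϖ^{-k}(y′ − y)`: Hermite class of `y` = class of `u` mod `ϖ^j`), `zpow_neg_mul_coe_mem_iff_dvd`,
  **`zpow_neg_mul_coe_sub_mem_iff_mk_eq_mk`** (`⟺ ū = ū′` in `𝒪 ⧸ 𝔪^j`), **`zpow_neg_mul_norm_add_one_mem_iff`** (`ϖ^{-j}(u σu + 1) ∈ 𝒪 ⟺ ū · σ̄ū = −1` in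
  `𝒪 ⧸ 𝔪^j`, the subtype of ★ (L5-c) `natCard_norm_fibre_quotient_pow` at `r = −1`), `valuation_eq_one_of_norm_congr` (`j ≥ 1 ⇒ |u| = 1`), and STABILITY over
  ★ `map_diag_span_eq_self_iff_of_hermite`: **`map_diag_span_eq_self_iff_of_selfDual_hermite`** — for `|a| = |c| = 1` and a self-dual `T(k, y, −k−e)`,
  `diag(a, c) Λ = Λ ⟺ ϖ^{-j}(a − c) ∈ 𝒪` («gap `j ≤ v(a − c) = N`»).
* §4 **`ncard_selfDual_hermite_eq_natCard`**: for `0 ≤ 2k + e`, the set of self-dual `Λ(g)`, `↑g = T(k, y, −k−e)`, has `ncard` equal to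
  `Nat.card {x : 𝒪 ⧸ 𝔪^j // x * σ̄ x = −1}` (`Λ ↦ ū`, ★ `span_eq_span_iff_of_hermite` + §3) — which ★ (L5-c) evaluates (`q^{j−1}(q+1)` for `j ≥ 1`, `1` for `j = 0`).
NOT here: the frame transport to `ϖ^e · 1` ((L5-d1)), the classes ((L5-e)), the finsum and the value ((L5-d2) ★ `UnitOrbitalIntegralHSideGluingSum`, (L5-d)).

## References
* [Jacobowitz1962] R. Jacobowitz, *Hermitian forms over local fields*, Amer. J. Math. 84 (1962), §7.
* [Flicker1998UnitaryFL] Y. Z. Flicker, *Elementary proof of the fundamental lemma for a unitary group*, Canad. J. Math. 50 (1998), §6 p. 95 (REMARK).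
* [Macdonald1995] I. G. Macdonald, *Symmetric functions and Hall polynomials*, 2nd ed. (1995), Ch. II §1, Ch. V §2.
* [Serre1979] J.-P. Serre, *Local Fields* (1979), Ch. V §2 Prop. 3.
-/

set_option autoImplicit false

noncomputable section

open scoped ValuativeRel Matrix MatrixGroups
open Matrix ValuativeRel IsLocalRing Literature.NumberTheory.LocalFields

namespace Literature.NumberTheory.Automorphic

variable {F : Type*} [Field F] [ValuativeRel F] {ϖ : F} (hϖ : IsUniformizingElement ϖ) (σ : F →+* F)

/-! ## §1 The Gram matrix of a Hermite matrix against `ϖ^e · 1` -/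

section Gram

include hϖ in
/-- `ϖ^d ∈ 𝒪 ⟺ 0 ≤ d`. [cite: Macdonald1995, Ch. II §1] -/
theorem zpow_uniformizer_mem_integer_iff (d : ℤ) : ϖ ^ d ∈ 𝒪[F] ↔ 0 ≤ d := by
  constructor
  · intro h
    by_contra hd
    have h' : ϖ ^ (-d) ∈ 𝒪[F] := by
      obtain ⟨n, hn⟩ := Int.eq_ofNat_of_zero_le (show 0 ≤ -d by omega)
      rw [hn, zpow_natCast]
      exact hϖ.pow_mem n
    have := hϖ.eq_zero_of_zpow_mem h h'
    omega
  · intro h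
    obtain ⟨n, rfl⟩ := Int.eq_ofNat_of_zero_le h
    rw [zpow_natCast]
    exact hϖ.pow_mem n

omit [ValuativeRel F] in
/-- **The Gram matrix of `T(k, y, l) = [[ϖ^k, y], [0, ϖ^l]]` for the form `ϖ^e · 1`** (`σ ϖ = ϖ`):
`σ(T)ᵀ (ϖ^e 1) T = [[ϖ^{2k+e}, ϖ^{k+e} y], [ϖ^{k+e} σy, ϖ^e (σy·y + ϖ^{2l})]]`. [cite: Jacobowitz1962, §7] [cite: Macdonald1995, Ch. V §2] -/
theorem formCongr_hermite_smul_one (hϖ0 : ϖ ≠ 0) (hσϖ : σ ϖ = ϖ) {k l : ℤ} {y : F} (g : GL (Fin 2) F)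
    (hg : (g : Matrix (Fin 2) (Fin 2) F) = !![ϖ ^ k, y; 0, ϖ ^ l]) (e : ℤ) :
    formCongr σ g (ϖ ^ e • (1 : Matrix (Fin 2) (Fin 2) F)) =
      !![ϖ ^ (2 * k + e), ϖ ^ (k + e) * y; ϖ ^ (k + e) * σ y, ϖ ^ e * (σ y * y + ϖ ^ (2 * l))] := by
  have hσk : ∀ m : ℤ, σ (ϖ ^ m) = ϖ ^ m := fun m => by rw [map_zpow₀, hσϖ]
  have hmap : ((!![ϖ ^ k, y; 0, ϖ ^ l] : Matrix (Fin 2) (Fin 2) F).map σ)ᵀ = !![ϖ ^ k, 0; σ y, ϖ ^ l] := by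
    ext i j; fin_cases i <;> fin_cases j <;> simp [hσk]
  have hH : ϖ ^ e • (1 : Matrix (Fin 2) (Fin 2) F) = !![ϖ ^ e, 0; 0, ϖ ^ e] := by
    ext i j; fin_cases i <;> fin_cases j <;> simp
  have e11 : ϖ ^ k * ϖ ^ e * ϖ ^ k = ϖ ^ (2 * k + e) := by
    rw [← zpow_add₀ hϖ0, ← zpow_add₀ hϖ0]; congr 1; ring
  have e12 : ϖ ^ k * ϖ ^ e * y = ϖ ^ (k + e) * y := by rw [← zpow_add₀ hϖ0]
  have e21 : σ y * ϖ ^ e * ϖ ^ k = ϖ ^ (k + e) * σ y := by rw [mul_comm (σ y), mul_assoc, mul_comm (σ y), ← mul_assoc, ← zpow_add₀ hϖ0, add_comm]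
  have e22 : σ y * ϖ ^ e * y + ϖ ^ l * ϖ ^ e * ϖ ^ l = ϖ ^ e * (σ y * y + ϖ ^ (2 * l)) := by
    rw [two_mul, zpow_add₀ hϖ0]; ring
  rw [formCongr, hg, hmap, hH, Matrix.mul_fin_two, Matrix.mul_fin_two]
  simp only [mul_zero, zero_mul, add_zero, zero_add]
  rw [e11, e12, e21, e22]

end Gram

/-! ## §2 Self-duality of a Hermite lattice: «integral ⟺ unimodular», parity and the norm congruence -/

section SelfDual

include hϖ in
/-- **SELF-DUALITY IN HERMITE COORDINATES.**  For `σ ϖ = ϖ`, `σ 𝒪 ⊆ 𝒪`, `↑g = T(k, y, l)` and the form `ϖ^e · 1`, the Gram matrix `formCongr σ g (ϖ^e 1)`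
lies in `GL₂(𝒪)` (the socket's self-duality token `∃ J′ ∈ glInt 2 F, ↑J′ = …`) iff
`l = -k - e`, `0 ≤ 2k + e`, `u := ϖ^{k+e} y ∈ 𝒪` and `ϖ^{-(2k+e)} (u σu + 1) ∈ 𝒪` — with `l = -k - e` the Gram matrix is `[[ϖ^j, u], [σu, ϖ^{-j}(u σu + 1)]]`,
`j = 2k + e`, of determinant `1`, so «integral ⟺ unimodular»; for `j ≥ 1` the congruence `u σu ≡ -1 (ϖ^j)` forces `u` to be a unit (PARITY: the gap
`j ≡ e (mod 2)`; NORM CONGRUENCE: `N(u) ≡ -1`). [cite: Jacobowitz1962, §7] [cite: Flicker1998UnitaryFL, §6 p. 95] [cite: Macdonald1995, Ch. V §2] -/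
theorem exists_mem_glInt_coe_eq_formCongr_hermite_iff (hσϖ : σ ϖ = ϖ) (hσO : ∀ x ∈ 𝒪[F], σ x ∈ 𝒪[F]) {k l e : ℤ} {y : F}
    (g : GL (Fin 2) F) (hg : (g : Matrix (Fin 2) (Fin 2) F) = !![ϖ ^ k, y; 0, ϖ ^ l]) :
    (∃ J' ∈ glInt 2 F, (J' : Matrix (Fin 2) (Fin 2) F) = formCongr σ g (ϖ ^ e • (1 : Matrix (Fin 2) (Fin 2) F))) ↔
      l = -k - e ∧ 0 ≤ 2 * k + e ∧ ϖ ^ (k + e) * y ∈ 𝒪[F] ∧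
        ϖ ^ (-(2 * k + e)) * (ϖ ^ (k + e) * y * σ (ϖ ^ (k + e) * y) + 1) ∈ 𝒪[F] := by
  have h0 := hϖ.ne_zero
  have hσk : ∀ m : ℤ, σ (ϖ ^ m) = ϖ ^ m := fun m => by rw [map_zpow₀, hσϖ]
  have hG := formCongr_hermite_smul_one σ h0 hσϖ g hg e
  -- the determinant of the Gram matrix
  have hdet : (formCongr σ g (ϖ ^ e • (1 : Matrix (Fin 2) (Fin 2) F))).det = ϖ ^ (2 * (k + l + e)) := by
    rw [hG, Matrix.det_fin_two_of]
    have : ϖ ^ (2 * (k + l + e)) = ϖ ^ (2 * k + e) * (ϖ ^ e * ϖ ^ (2 * l)) := by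
      rw [← zpow_add₀ h0, ← zpow_add₀ h0]; congr 1; ring
    rw [this, two_mul k, add_assoc, zpow_add₀ h0, zpow_add₀ h0]
    ring
  -- the `(1,1)` entry rewritten in the `u`-coordinate when `l = -k - e`
  have h11 : l = -k - e → ϖ ^ e * (σ y * y + ϖ ^ (2 * l)) = ϖ ^ (-(2 * k + e)) * (ϖ ^ (k + e) * y * σ (ϖ ^ (k + e) * y) + 1) := by
    rintro rfl
    rw [map_mul, hσk]
    have e1 : ϖ ^ (2 * (-k - e)) = ϖ ^ (-(2 * k + e)) * ϖ ^ (-e) := by rw [← zpow_add₀ h0]; congr 1; ring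
    have e2 : ϖ ^ (-(2 * k + e)) * ϖ ^ (k + e) * ϖ ^ (k + e) = ϖ ^ e := by
      rw [← zpow_add₀ h0, ← zpow_add₀ h0]; congr 1; ring
    have e3 : ϖ ^ e * ϖ ^ (-e) = 1 := by rw [← zpow_add₀ h0, add_neg_cancel, zpow_zero]
    rw [e1]
    linear_combination (-(σ y * y)) * e2 + ϖ ^ (-(2 * k + e)) * e3
  constructor
  · rintro ⟨J', hJ', hJ'e⟩
    obtain ⟨h1, h2⟩ := (mem_glInt_iff J').1 hJ'
    -- `det J′` and `det J′⁻¹` are integral, so `2(k + l + e) = 0`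
    have hd1 : ϖ ^ (2 * (k + l + e)) ∈ 𝒪[F] := by
      rw [← hdet, ← hJ'e, Matrix.det_fin_two]
      exact Subring.sub_mem _ (Subring.mul_mem _ (h1 0 0) (h1 1 1)) (Subring.mul_mem _ (h1 0 1) (h1 1 0))
    have hd2 : ϖ ^ (-(2 * (k + l + e))) ∈ 𝒪[F] := by
      have hdi : ((J'⁻¹ : GL (Fin 2) F) : Matrix (Fin 2) (Fin 2) F).det = ϖ ^ (-(2 * (k + l + e))) := by
        rw [← Matrix.GeneralLinearGroup.val_det_apply, map_inv, Units.val_inv_eq_inv_val, Matrix.GeneralLinearGroup.val_det_apply, hJ'e, hdet,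
          _root_.zpow_neg]
      rw [← hdi, Matrix.det_fin_two]
      exact Subring.sub_mem _ (Subring.mul_mem _ (h2 0 0) (h2 1 1)) (Subring.mul_mem _ (h2 0 1) (h2 1 0))
    have hl : l = -k - e := by
      have := hϖ.eq_zero_of_zpow_mem hd1 hd2
      omega
    have h00 : ϖ ^ (2 * k + e) ∈ 𝒪[F] := by simpa [hJ'e, hG] using h1 0 0
    have h01 : ϖ ^ (k + e) * y ∈ 𝒪[F] := by simpa [hJ'e, hG] using h1 0 1
    have h11' : ϖ ^ e * (σ y * y + ϖ ^ (2 * l)) ∈ 𝒪[F] := by simpa [hJ'e, hG] using h1 1 1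
    exact ⟨hl, (zpow_uniformizer_mem_integer_iff hϖ _).1 h00, h01, (h11 hl) ▸ h11'⟩
  · rintro ⟨hl, hke, hu, hN⟩
    have hdet1 : (formCongr σ g (ϖ ^ e • (1 : Matrix (Fin 2) (Fin 2) F))).det = 1 := by
      rw [hdet, hl, show 2 * (k + (-k - e) + e) = (0 : ℤ) by ring, zpow_zero]
    refine ⟨Matrix.GeneralLinearGroup.mkOfDetNeZero _ (by rw [hdet1]; exact one_ne_zero), (mem_glInt_iff _).2 ⟨?_, ?_⟩,
      Matrix.GeneralLinearGroup.val_mkOfDetNeZero _ _⟩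
    · intro i j
      rw [Matrix.GeneralLinearGroup.val_mkOfDetNeZero, hG]
      have h10 : ϖ ^ (k + e) * σ y ∈ 𝒪[F] := by
        have := hσO _ hu
        rwa [map_mul, hσk] at this
      fin_cases i <;> fin_cases j
      · simpa using (zpow_uniformizer_mem_integer_iff hϖ _).2 hke
      · simpa using hu
      · simpa using h10
      · simpa [h11 hl] using hN
    · intro i j
      rw [Matrix.coe_units_inv, Matrix.GeneralLinearGroup.val_mkOfDetNeZero, Matrix.inv_def, hdet1, Ring.inverse_one, one_smul, hG,
        Matrix.adjugate_fin_two_of]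
      have h10 : ϖ ^ (k + e) * σ y ∈ 𝒪[F] := by
        have := hσO _ hu
        rwa [map_mul, hσk] at this
      fin_cases i <;> fin_cases j
      · simpa [h11 hl] using hN
      · simpa using Subring.neg_mem _ hu
      · simpa using Subring.neg_mem _ h10
      · simpa using (zpow_uniformizer_mem_integer_iff hϖ _).2 hke

end SelfDual

/-! ## §3 The `u`-coordinate `u = ϖ^{k+e} y`: classes mod `ϖ^j`, the norm congruence in `𝒪 ⧸ 𝔪^j`, units, stability -/

section Coordinates

omit [ValuativeRel F] in
/-- The Hermite class of `y` mod `ϖ^k 𝒪` is the class of `u = ϖ^{k+e} y` mod `ϖ^{2k+e} 𝒪`: `ϖ^{-(2k+e)}(u′ − u) = ϖ^{-k}(y′ − y)`. [cite: Macdonald1995, Ch. V §2] -/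
theorem zpow_neg_mul_sub_eq (hϖ0 : ϖ ≠ 0) (k e : ℤ) (y y' : F) :
    ϖ ^ (-(2 * k + e)) * (ϖ ^ (k + e) * y' - ϖ ^ (k + e) * y) = ϖ ^ (-k) * (y' - y) := by
  rw [← mul_sub, ← mul_assoc, ← zpow_add₀ hϖ0]
  congr 2
  ring

omit [ValuativeRel F] in
/-- The stability corner in the `u`-coordinate: `ϖ^{-k}((a − c) y) = ϖ^{-(2k+e)}((a − c) u)`. [cite: Macdonald1995, Ch. V §2] -/
theorem zpow_neg_mul_sub_mul_eq (hϖ0 : ϖ ≠ 0) (k e : ℤ) (a c y : F) :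
    ϖ ^ (-k) * ((a - c) * y) = ϖ ^ (-(2 * k + e)) * ((a - c) * (ϖ ^ (k + e) * y)) := by
  rw [mul_left_comm (a - c), ← mul_assoc (ϖ ^ (-(2 * k + e))), ← zpow_add₀ hϖ0]
  congr 2
  ring

/-- A unit factor does not change integrality: for `|u| = 1`, `z u ∈ 𝒪 ⟺ z ∈ 𝒪`. [cite: Macdonald1995, Ch. V §2] -/
theorem mul_mem_integer_iff_of_valuation_eq_one {u : F} (hu : valuation F u = 1) (z : F) : z * u ∈ 𝒪[F] ↔ z ∈ 𝒪[F] := by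
  rw [Valuation.mem_integer_iff, Valuation.mem_integer_iff, map_mul, hu, mul_one]

include hϖ in
/-- `ϖ^{-j} x ∈ 𝒪 ⟺ ϖ^j ∣ x` in `𝒪` (`x ∈ 𝒪`, `j ∈ ℕ`). [cite: Macdonald1995, Ch. II §1] -/
theorem zpow_neg_mul_coe_mem_iff_dvd (j : ℕ) (x : 𝒪[F]) :
    ϖ ^ (-(j : ℤ)) * (x : F) ∈ 𝒪[F] ↔ (⟨ϖ, hϖ.mem⟩ : 𝒪[F]) ^ j ∣ x := by
  have h0 := hϖ.ne_zero
  constructor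
  · intro h
    refine ⟨⟨_, h⟩, Subtype.ext ?_⟩
    simp only [Subring.coe_mul, Subring.coe_pow]
    rw [← mul_assoc, _root_.zpow_neg, zpow_natCast, mul_inv_cancel₀ (pow_ne_zero _ h0), one_mul]
  · rintro ⟨d, hd⟩
    rw [hd, Subring.coe_mul, Subring.coe_pow, ← mul_assoc, _root_.zpow_neg, zpow_natCast, inv_mul_cancel₀ (pow_ne_zero _ h0), one_mul]
    exact d.2

include hϖ in
/-- **Classes mod `ϖ^j`**: for `u, u′ ∈ 𝒪`, `ϖ^{-j}(u − u′) ∈ 𝒪 ⟺ u ≡ u′ in `𝒪 ⧸ 𝔪^j` (`𝔪 = ϖ 𝒪`). [cite: Macdonald1995, Ch. II §1] -/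
theorem zpow_neg_mul_coe_sub_mem_iff_mk_eq_mk (j : ℕ) (u u' : 𝒪[F]) :
    ϖ ^ (-(j : ℤ)) * ((u : F) - u') ∈ 𝒪[F] ↔ Ideal.Quotient.mk (maximalIdeal 𝒪[F] ^ j) u = Ideal.Quotient.mk (maximalIdeal 𝒪[F] ^ j) u' := by
  rw [Ideal.Quotient.eq, hϖ.span_eq, Ideal.span_singleton_pow, Ideal.mem_span_singleton, ← zpow_neg_mul_coe_mem_iff_dvd hϖ j (u - u')]
  rfl

include hϖ in
/-- **The norm congruence in `𝒪 ⧸ 𝔪^j`**: for `u ∈ 𝒪` and the restriction `σO` of `σ` to `𝒪`, `ϖ^{-j}(u σu + 1) ∈ 𝒪 ⟺ ū · σ̄ū = −1` in `𝒪 ⧸ 𝔪^j` — the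
subtype counted by ★ (L5-c) `natCard_norm_fibre_quotient_pow` (`r = −1`). [cite: Flicker1998UnitaryFL, §6 p. 95] [cite: Serre1979, Ch. V §2 Prop. 3] -/
theorem zpow_neg_mul_norm_add_one_mem_iff (σO : 𝒪[F] →+* 𝒪[F]) (hσO : ∀ x : 𝒪[F], ((σO x : 𝒪[F]) : F) = σ x) (hσσ : ∀ a, σO (σO a) = a)
    (j : ℕ) (u : 𝒪[F]) :
    ϖ ^ (-(j : ℤ)) * ((u : F) * σ u + 1) ∈ 𝒪[F] ↔
      Ideal.Quotient.mk (maximalIdeal 𝒪[F] ^ j) u *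
          Ideal.quotientMap (maximalIdeal 𝒪[F] ^ j) σO (UnramifiedQuadraticNorm.maximalIdeal_pow_le_comap σO hσσ j)
            (Ideal.Quotient.mk (maximalIdeal 𝒪[F] ^ j) u) =
        Ideal.Quotient.mk (maximalIdeal 𝒪[F] ^ j) (-1) := by
  rw [Ideal.quotientMap_mk, ← map_mul, Ideal.Quotient.eq, hϖ.span_eq, Ideal.span_singleton_pow, Ideal.mem_span_singleton,
    ← zpow_neg_mul_coe_mem_iff_dvd hϖ j (u * σO u - -1)]
  simp only [sub_neg_eq_add, Subring.coe_add, Subring.coe_mul, Subring.coe_one, hσO]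

include hϖ in
/-- **`j ≥ 1` forces `u` to be a unit**: if `u ∈ 𝒪`, `σ 𝒪 ⊆ 𝒪` and `ϖ^{-j}(u σu + 1) ∈ 𝒪` with `j ≥ 1`, then `|u| = 1` (else `|u σu| < 1`, `|u σu + 1| = 1` and
`ϖ^{-j} ∈ 𝒪`). [cite: Flicker1998UnitaryFL, §6 p. 95] [cite: Jacobowitz1962, §7] -/
theorem valuation_eq_one_of_norm_congr (hσO : ∀ x ∈ 𝒪[F], σ x ∈ 𝒪[F]) {j : ℤ} (hj : 1 ≤ j) {u : F} (hu : u ∈ 𝒪[F])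
    (hN : ϖ ^ (-j) * (u * σ u + 1) ∈ 𝒪[F]) : valuation F u = 1 := by
  have hu1 : valuation F u ≤ 1 := (Valuation.mem_integer_iff _ _).1 hu
  by_contra hne
  have hlt : valuation F (u * σ u) < 1 := by
    rw [map_mul]
    calc valuation F u * valuation F (σ u) ≤ valuation F u * 1 :=
          mul_le_mul' le_rfl ((Valuation.mem_integer_iff _ _).1 (hσO u hu))
      _ < 1 := by rw [mul_one]; exact lt_of_le_of_ne hu1 hne
  have h1 : valuation F (u * σ u + 1) = 1 := by rw [add_comm]; exact (valuation F).map_one_add_of_lt hlt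
  have hmem : ϖ ^ (-j) ∈ 𝒪[F] := by
    have h2 : ϖ ^ (-j) * (u * σ u + 1) * (u * σ u + 1)⁻¹ ∈ 𝒪[F] :=
      Subring.mul_mem _ hN ((Valuation.mem_integer_iff _ _).2 (by rw [map_inv₀, h1, inv_one]))
    have hne0 : u * σ u + 1 ≠ 0 := fun h => by rw [h, map_zero] at h1; exact zero_ne_one h1
    rwa [mul_assoc, mul_inv_cancel₀ hne0, mul_one] at h2
  have := (zpow_uniformizer_mem_integer_iff hϖ _).1 hmem
  omega

include hϖ in
/-- **STABILITY OF A SELF-DUAL HERMITE LATTICE UNDER `diag(a, c)` ⟺ `ϖ^{-j}(a − c) ∈ 𝒪`** (`j = 2k + e`, i.e. «gap `j ≤ v(a − c)`»): for `|a| = |c| = 1`,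
`↑g = T(k, y, −k−e)` self-dual for `ϖ^e · 1` (§2), over ★ `map_diag_span_eq_self_iff_of_hermite` (`j ≥ 1`: `u` is a unit, §3; `j = 0`: both sides hold).
[cite: Flicker1998UnitaryFL, §6 p. 95] [cite: Macdonald1995, Ch. V §2] -/
theorem map_diag_span_eq_self_iff_of_selfDual_hermite (hσϖ : σ ϖ = ϖ) (hσO : ∀ x ∈ 𝒪[F], σ x ∈ 𝒪[F]) {k e : ℤ} {y a c : F}
    (γ g : GL (Fin 2) F) (hγ : (γ : Matrix (Fin 2) (Fin 2) F) = !![a, 0; 0, c]) (ha : valuation F a = 1) (hc : valuation F c = 1)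
    (hg : (g : Matrix (Fin 2) (Fin 2) F) = !![ϖ ^ k, y; 0, ϖ ^ (-k - e)])
    (hself : ∃ J' ∈ glInt 2 F, (J' : Matrix (Fin 2) (Fin 2) F) = formCongr σ g (ϖ ^ e • (1 : Matrix (Fin 2) (Fin 2) F))) :
    (Submodule.span 𝒪[F] (Set.range ((g : Matrix (Fin 2) (Fin 2) F))ᵀ)).map
        ((Matrix.toLin' (γ : Matrix (Fin 2) (Fin 2) F)).restrictScalars 𝒪[F]) =
      Submodule.span 𝒪[F] (Set.range ((g : Matrix (Fin 2) (Fin 2) F))ᵀ) ↔ ϖ ^ (-(2 * k + e)) * (a - c) ∈ 𝒪[F] := by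
  have h0 := hϖ.ne_zero
  obtain ⟨-, hke, hu, hN⟩ := (exists_mem_glInt_coe_eq_formCongr_hermite_iff hϖ σ hσϖ hσO g hg).1 hself
  rw [map_diag_span_eq_self_iff_of_hermite hϖ γ g hγ ha hc hg, zpow_neg_mul_sub_mul_eq h0 k e]
  have haO : a ∈ 𝒪[F] := (Valuation.mem_integer_iff _ _).2 ha.le
  have hcO : c ∈ 𝒪[F] := (Valuation.mem_integer_iff _ _).2 hc.le
  rcases (show 2 * k + e = 0 ∨ 1 ≤ 2 * k + e by omega) with hj | hj
  · rw [hj, neg_zero, zpow_zero, one_mul, one_mul]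
    exact ⟨fun _ => Subring.sub_mem _ haO hcO, fun _ => Subring.mul_mem _ (Subring.sub_mem _ haO hcO) hu⟩
  · rw [← mul_assoc, mul_mem_integer_iff_of_valuation_eq_one (valuation_eq_one_of_norm_congr hϖ σ hσO hj hu hN)]

end Coordinates

/-! ## §4 Counting the self-dual Hermite classes with exponent `k`: `u mod ϖ^j` with `u σ̄u = −1` -/

section Count

include hϖ in
/-- **THE SELF-DUAL HERMITE CLASSES WITH EXPONENT `k` ARE COUNTED BY THE NORM FIBRE OVER `−1` IN `𝒪 ⧸ 𝔪^j`**, `j = 2k + e ≥ 0`: the set of lattices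
`Λ(g)`, `↑g = T(k, y, −k−e)` self-dual for `ϖ^e · 1`, has `ncard` equal to `Nat.card {ū ∈ 𝒪 ⧸ 𝔪^j : ū · σ̄ū = −1}` — via `Λ ↦ u = ϖ^{k+e} y mod ϖ^j`
(★ `span_eq_span_iff_of_hermite` + §3), the subtype ★ (L5-c) `natCard_norm_fibre_quotient_pow` evaluates to `q^{j−1}(q+1)` (`j ≥ 1`; `1` for `j = 0`).
[cite: Flicker1998UnitaryFL, §6 p. 95] [cite: Jacobowitz1962, §7] [cite: Serre1979, Ch. V §2 Prop. 3] -/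
theorem ncard_selfDual_hermite_eq_natCard (hσϖ : σ ϖ = ϖ) (σO : 𝒪[F] →+* 𝒪[F]) (hσO : ∀ x : 𝒪[F], ((σO x : 𝒪[F]) : F) = σ x)
    (hσσ : ∀ a, σO (σO a) = a) {k e : ℤ} (hke : 0 ≤ 2 * k + e) :
    {Λ : Submodule 𝒪[F] (Fin 2 → F) | ∃ (y : F) (g : GL (Fin 2) F), (g : Matrix (Fin 2) (Fin 2) F) = !![ϖ ^ k, y; 0, ϖ ^ (-k - e)] ∧
        (∃ J' ∈ glInt 2 F, (J' : Matrix (Fin 2) (Fin 2) F) = formCongr σ g (ϖ ^ e • (1 : Matrix (Fin 2) (Fin 2) F))) ∧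
        Λ = Submodule.span 𝒪[F] (Set.range ((g : Matrix (Fin 2) (Fin 2) F))ᵀ)}.ncard =
      Nat.card {x : 𝒪[F] ⧸ maximalIdeal 𝒪[F] ^ (2 * k + e).toNat //
        x * Ideal.quotientMap (maximalIdeal 𝒪[F] ^ (2 * k + e).toNat) σO
            (UnramifiedQuadraticNorm.maximalIdeal_pow_le_comap σO hσσ _) x = Ideal.Quotient.mk _ (-1)} := by
  classical
  have h0 := hϖ.ne_zero
  have hσO' : ∀ x ∈ 𝒪[F], σ x ∈ 𝒪[F] := fun x hx => by rw [← hσO ⟨x, hx⟩]; exact SetLike.coe_mem _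
  set j : ℕ := (2 * k + e).toNat with hjdef
  have hj : (j : ℤ) = 2 * k + e := Int.toNat_of_nonneg hke
  set I : Ideal 𝒪[F] := maximalIdeal 𝒪[F] ^ j with hI
  -- a Hermite matrix `T(k, y, -k-e)` as an element of `GL₂(F)`
  have hdetT : ∀ y : F, (!![ϖ ^ k, y; 0, ϖ ^ (-k - e)] : Matrix (Fin 2) (Fin 2) F).det ≠ 0 := fun y => by
    rw [Matrix.det_fin_two_of, mul_zero, sub_zero]; exact mul_ne_zero (zpow_ne_zero _ h0) (zpow_ne_zero _ h0)
  -- lifts of residue classes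
  have hlift : ∀ x : 𝒪[F] ⧸ I, ∃ u : 𝒪[F], Ideal.Quotient.mk I u = x := fun x => Ideal.Quotient.mk_surjective x
  choose lift hlift using hlift
  have hzz : ϖ ^ (k + e) * ϖ ^ (-(k + e)) = 1 := by rw [← zpow_add₀ h0, add_neg_cancel, zpow_zero]
  -- the norm congruence ↔ membership of the class in the fibre over `-1`
  have hcong : ∀ u : 𝒪[F], ϖ ^ (-(2 * k + e)) * ((u : F) * σ u + 1) ∈ 𝒪[F] ↔
      Ideal.Quotient.mk I u * Ideal.quotientMap I σO (UnramifiedQuadraticNorm.maximalIdeal_pow_le_comap σO hσσ j) (Ideal.Quotient.mk I u) =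
        Ideal.Quotient.mk I (-1) := fun u => by
    rw [← hj]; exact zpow_neg_mul_norm_add_one_mem_iff hϖ σ σO hσO hσσ j u
  change _ = Nat.card ({x : 𝒪[F] ⧸ I | x * Ideal.quotientMap I σO (UnramifiedQuadraticNorm.maximalIdeal_pow_le_comap σO hσσ j) x =
    Ideal.Quotient.mk I (-1)} : Set (𝒪[F] ⧸ I))
  rw [Nat.card_coe_set_eq]
  symm
  refine Set.ncard_congr
    (fun x _ => Submodule.span 𝒪[F] (Set.range
      (!![ϖ ^ k, ϖ ^ (-(k + e)) * (lift x : F); 0, ϖ ^ (-k - e)] : Matrix (Fin 2) (Fin 2) F)ᵀ)) ?_ ?_ ?_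
  · -- the lattice of a class is self-dual Hermite with exponent `k`
    intro x hx
    refine ⟨ϖ ^ (-(k + e)) * (lift x : F), Matrix.GeneralLinearGroup.mkOfDetNeZero _ (hdetT _),
      Matrix.GeneralLinearGroup.val_mkOfDetNeZero _ _, ?_, by rw [Matrix.GeneralLinearGroup.val_mkOfDetNeZero]⟩
    refine (exists_mem_glInt_coe_eq_formCongr_hermite_iff hϖ σ hσϖ hσO' _ (Matrix.GeneralLinearGroup.val_mkOfDetNeZero _ _)).2
      ⟨rfl, hke, ?_, ?_⟩
    · rw [← mul_assoc, hzz, one_mul]; exact SetLike.coe_mem _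
    · rw [← mul_assoc, hzz, one_mul]
      exact (hcong (lift x)).2 (by rw [hlift]; exact hx)
  · -- injective: equal lattices have congruent `u`-coordinates
    intro x x' hx hx' hxx'
    have h := (span_eq_span_iff_of_hermite hϖ (Matrix.GeneralLinearGroup.mkOfDetNeZero _ (hdetT _))
      (Matrix.GeneralLinearGroup.mkOfDetNeZero _ (hdetT _)) (Matrix.GeneralLinearGroup.val_mkOfDetNeZero _ _)
      (Matrix.GeneralLinearGroup.val_mkOfDetNeZero _ _)).1 hxx'
    obtain ⟨-, -, h3⟩ := h
    rw [← zpow_neg_mul_sub_eq h0 k e, ← mul_assoc, hzz, one_mul, ← mul_assoc, hzz, one_mul, ← hj,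
      zpow_neg_mul_coe_sub_mem_iff_mk_eq_mk hϖ j] at h3
    rw [← hlift x, ← hlift x', h3]
  · -- surjective: a self-dual Hermite lattice comes from the class of its `u`-coordinate
    rintro Λ ⟨y, g, hg, hself, rfl⟩
    obtain ⟨-, -, hu, hN⟩ := (exists_mem_glInt_coe_eq_formCongr_hermite_iff hϖ σ hσϖ hσO' g hg).1 hself
    refine ⟨Ideal.Quotient.mk I ⟨_, hu⟩, (hcong ⟨_, hu⟩).1 hN, ?_⟩
    refine span_eq_span_of_hermite_of_sub_mem hϖ (Matrix.GeneralLinearGroup.mkOfDetNeZero _ (hdetT _)) g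
      (Matrix.GeneralLinearGroup.val_mkOfDetNeZero _ _) hg ?_
    have h4 : ϖ ^ (-(j : ℤ)) * (((lift (Ideal.Quotient.mk I ⟨_, hu⟩) : 𝒪[F]) : F) - ((⟨ϖ ^ (k + e) * y, hu⟩ : 𝒪[F]) : F)) ∈ 𝒪[F] :=
      (zpow_neg_mul_coe_sub_mem_iff_mk_eq_mk hϖ j _ _).2 (hlift _)
    rw [hj] at h4
    rw [← zpow_neg_mul_sub_eq h0 k e, ← mul_assoc, hzz, one_mul]
    have : ϖ ^ (-(2 * k + e)) * (ϖ ^ (k + e) * y - (lift (Ideal.Quotient.mk I ⟨_, hu⟩) : F)) =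
        -(ϖ ^ (-(2 * k + e)) * (((lift (Ideal.Quotient.mk I ⟨_, hu⟩) : 𝒪[F]) : F) - ((⟨ϖ ^ (k + e) * y, hu⟩ : 𝒪[F]) : F))) := by
      push_cast
      ring
    rw [this]
    exact Subring.neg_mem _ h4

end Count

end Literature.NumberTheory.Automorphic

end
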